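import Mathlib
import Summits.ValiantsHypothesis.ValiantsHypothesis.Theses.FifoMatching
import Summits.ValiantsHypothesis.ValiantsHypothesis.Theorems.FifoMatchingNNLinearDegreeCofactorHardAvoidingCounts
import Summits.ValiantsHypothesis.ValiantsHypothesis.Theorems.FifoMatchingNNLinearDegreeCofactorHardCountsGlue
import Summits.ValiantsHypothesis.ValiantsHypothesis.Theorems.FifoMatchingNNLinearDegreeCofactorHardStubTopInternalComponent
import Summits.ValiantsHypothesis.ValiantsHypothesis.Theorems.FifoMatchingNNLinearDegreeCofactorHardStubLongRunInternalHard
import HarnessLib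

/-!
# Route `FifoMatching`, crux `NNLinearDegreeCofactorHard` (stmt-ValiantsHypothesis-23918), line `internal_cofactor`:
# the crux from a pricing, for ANY density constant `a ≥ 28`

Verbatim the landed glue of LEAD p2 (`InternalCofactor.avoidingCounts28_of_pricing`, p602549, and
`InternalCofactor.nnLinearDegreeCofactorHard_of_avoidingCounts28`, p599455) with the density constant `28` replaced by a parameter
`a ≥ 28` (p3's `denseInternalHard_of_counts a` is already parametric; S1/S2a are unchanged; the crux has `∃ a`).  The ∀c measure
μ* = `shedWord` needs a larger `a`: its free-mass budget is `N/6 − 4|R′| − o(N)` with `|R′| ≲ N/a`.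

* `avoidingCounts_of_pricing a ha r hμ hr` — the counts hypothesis of `denseInternalHard_of_counts a` from a pricing with rate `r`;
* `nnLinearDegreeCofactorHard_of_avoidingCounts a ha h` — the crux BY NAME from those counts.

Honest framing: CONDITIONAL assemblies (hypotheses = the pricing / the counts); nothing here proves them, S2b, the crux or
VP ≠ VNP (NOT proved).  No definitions, no named facts. [folklore]
-/

noncomputable section

-- Sub = Summit single-conjunct layout: the duplicated namespace component is mandated by the tree.
set_option linter.dupNamespace false

namespace Summit.ValiantsHypothesis.ValiantsHypothesis.Theorems.FifoMatching.NNLinearDegreeCofactorHard.InternalCofactor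

open MvPolynomial Finset Literature.Computability.AlgebraicComplexity
open Summit.ValiantsHypothesis.ValiantsHypothesis.Theorems.FifoMatching.NNLowDegreeCofactorHard.FreedVertices.Carve
open Summit.ValiantsHypothesis.ValiantsHypothesis.Theorems.FifoMatching.NNLinearDegreeCofactorHard
open Summit.ValiantsHypothesis.ValiantsHypothesis.Theorems.FifoMatching.NNLinearDegreeCofactorHard.CondProbBits
open scoped NNReal

/-- **The counts for density `a` from a pricing** (as `avoidingCounts28_of_pricing`, any `a ≥ 28`). [folklore] -/
theorem avoidingCounts_of_pricing (a : ℕ) (ha : 28 ≤ a) (r : ℕ → ℕ)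
    (hμ : ∀ n : ℕ, ∀ R : Finset (Fin (2 * n)), a * R.card ≤ 2 * n →
      ∀ C : Carving n, 3 ≤ C.m → 2 * n ≤ 2 * C.m + 12 * R.card + 4 →
        (∀ t ≤ 2 * C.m,
          4 * ((univ.filter fun j : Fin (2 * C.m) => C.up j ∈ R).filter fun j => j.val < t).card ≤ t ∧
          4 * ((univ.filter fun j : Fin (2 * C.m) => C.up j ∈ R).filter
            fun j => 2 * C.m ≤ j.val + t).card ≤ t) →
        ∃ B : ℕ, ∃ BB : Finset (Fin B → Bool), ∃ f : (Fin B → Bool) → (Fin (2 * C.m) → Fin (2 * C.m)),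
          BB.Nonempty ∧
          (∀ y ∈ BB, f y ∈ (nestFreeMatchings (2 * C.m)).filter
            (fun N => ∀ j ∈ (univ.filter fun j : Fin (2 * C.m) => C.up j ∈ R),
              N j ∉ (univ.filter fun j : Fin (2 * C.m) => C.up j ∈ R))) ∧
          (2 : ℝ) ^ B ≤ 2 * BB.card ∧
          ∀ S : Finset (Fin (2 * C.m)), 2 * C.m < 3 * S.card → 3 * S.card ≤ 4 * C.m →
            ((BB.filter fun y => ∀ i, i ∈ S ↔ f y i ∈ S).card : ℝ) * (4 / 3 : ℝ) ^ (r C.m) ≤ 2 ^ B)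
    (hr : ∀ c : ℕ, ∃ n₀ : ℕ, ∀ n ≥ n₀, ∀ M : ℕ, n ≤ 14 * (M + 2) →
      (8 * (2 ^ ((Nat.log 2 n + c) ^ c) + 1) * (M + 1) ^ 2 : ℝ) * (3 / 4 : ℝ) ^ (r M) < 1) :
    ∀ c : ℕ, ∃ n₀ : ℕ, ∀ n ≥ n₀, ∀ R : Finset (Fin (2 * n)), a * R.card ≤ 2 * n →
      (¬ ∃ s : ℕ, s + (2 * ((Nat.log 2 n + c) ^ c + Nat.log 2 n + 1) ^ 6 + 12) ≤ 2 * n ∧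
        ∀ j : Fin (2 * n), s ≤ j.val →
          j.val < s + (2 * ((Nat.log 2 n + c) ^ c + Nat.log 2 n + 1) ^ 6 + 12) → j ∉ R) →
      ∀ C : Carving n, 3 ≤ C.m → 2 * n ≤ 2 * C.m + 12 * R.card + 4 →
        (∀ t ≤ 2 * C.m,
          4 * ((univ.filter fun j : Fin (2 * C.m) => C.up j ∈ R).filter fun j => j.val < t).card ≤ t ∧
          4 * ((univ.filter fun j : Fin (2 * C.m) => C.up j ∈ R).filter
            fun j => 2 * C.m ≤ j.val + t).card ≤ t) →
        ∃ B : ℕ, ∃ BB : Finset (Fin B → Bool), ∃ f : (Fin B → Bool) → (Fin (2 * C.m) → Fin (2 * C.m)),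
          BB.Nonempty ∧
          (∀ y ∈ BB, f y ∈ (nestFreeMatchings (2 * C.m)).filter
            (fun N => ∀ j ∈ (univ.filter fun j : Fin (2 * C.m) => C.up j ∈ R),
              N j ∉ (univ.filter fun j : Fin (2 * C.m) => C.up j ∈ R))) ∧
          ∀ S : Finset (Fin (2 * C.m)), 2 * C.m < 3 * S.card → 3 * S.card ≤ 4 * C.m →
            (4 * (2 ^ ((Nat.log 2 n + c) ^ c) + 1) * (C.m + 1) ^ 2) *
              (BB.filter fun y => ∀ i, i ∈ S ↔ f y i ∈ S).card < BB.card := by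
  intro c
  obtain ⟨n₀, hn₀⟩ := hr c
  refine ⟨n₀, fun n hn R hR _ C hm hnC hends => ?_⟩
  obtain ⟨B, BB, f, hne, hsupp, hband, hprice⟩ := hμ n R hR C hm hnC hends
  refine ⟨B, BB, f, hne, hsupp, fun S hS1 hS2 => ?_⟩
  have hM : n ≤ 14 * (C.m + 2) := by nlinarith
  have har := hn₀ n hn C.m hM
  have har' : (8 * ((2 ^ ((Nat.log 2 n + c) ^ c) : ℕ) + 1) * (C.m + 1) ^ 2 : ℝ) * (3 / 4 : ℝ) ^ (r C.m) < 1 := by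
    push_cast
    exact har
  have key := counts_of_pricing (K := 2 ^ ((Nat.log 2 n + c) ^ c)) (hprice S hS1 hS2) hband har'
  simpa [mul_assoc] using key

/-- **`NNLinearDegreeCofactorHard` from the avoiding counts at density `a ≥ 28`** (as
`nnLinearDegreeCofactorHard_of_avoidingCounts28`). [folklore] -/
theorem nnLinearDegreeCofactorHard_of_avoidingCounts (a : ℕ) (ha : 28 ≤ a)
    (h : ∀ c : ℕ, ∃ n₀ : ℕ, ∀ n ≥ n₀, ∀ R : Finset (Fin (2 * n)), a * R.card ≤ 2 * n →
      (¬ ∃ s : ℕ, s + (2 * ((Nat.log 2 n + c) ^ c + Nat.log 2 n + 1) ^ 6 + 12) ≤ 2 * n ∧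
        ∀ j : Fin (2 * n), s ≤ j.val →
          j.val < s + (2 * ((Nat.log 2 n + c) ^ c + Nat.log 2 n + 1) ^ 6 + 12) → j ∉ R) →
      ∀ C : Carving n, 3 ≤ C.m → 2 * n ≤ 2 * C.m + 12 * R.card + 4 →
        (∀ t ≤ 2 * C.m,
          4 * ((univ.filter fun j : Fin (2 * C.m) => C.up j ∈ R).filter fun j => j.val < t).card ≤ t ∧
          4 * ((univ.filter fun j : Fin (2 * C.m) => C.up j ∈ R).filter
            fun j => 2 * C.m ≤ j.val + t).card ≤ t) →
        ∃ B : ℕ, ∃ BB : Finset (Fin B → Bool), ∃ f : (Fin B → Bool) → (Fin (2 * C.m) → Fin (2 * C.m)),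
          BB.Nonempty ∧
          (∀ y ∈ BB, f y ∈ (nestFreeMatchings (2 * C.m)).filter
            (fun N => ∀ j ∈ (univ.filter fun j : Fin (2 * C.m) => C.up j ∈ R),
              N j ∉ (univ.filter fun j : Fin (2 * C.m) => C.up j ∈ R))) ∧
          ∀ S : Finset (Fin (2 * C.m)), 2 * C.m < 3 * S.card → 3 * S.card ≤ 4 * C.m →
            (4 * (2 ^ ((Nat.log 2 n + c) ^ c) + 1) * (C.m + 1) ^ 2) *
              (BB.filter fun y => ∀ i, i ∈ S ↔ f y i ∈ S).card < BB.card) :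
    Summit.ValiantsHypothesis.ValiantsHypothesis.Theses.FifoMatching.NNLinearDegreeCofactorHard := by
  have hS2b := denseInternalHard_of_counts a ha h
  refine ⟨a, fun c => ?_⟩
  obtain ⟨n₁, hn₁⟩ := stub_longRunInternalHard c
  obtain ⟨n₂, hn₂⟩ := hS2b c
  refine ⟨max n₁ n₂, fun n hn g hg hdeg => ?_⟩
  obtain ⟨R, hR, p, hp, hpdeg, hint, hpc⟩ := stub_topInternalComponent n g hg
  have hRa : a * R.card ≤ 2 * n :=
    calc a * R.card ≤ a * (2 * g.totalDegree) := Nat.mul_le_mul_left a hR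
      _ = 2 * (a * g.totalDegree) := by ring
      _ ≤ 2 * n := Nat.mul_le_mul_left 2 hdeg
  have hpa : a * p.totalDegree ≤ n := (Nat.mul_le_mul_left a hpdeg).trans hdeg
  have key : 2 ^ ((Nat.log 2 n + c) ^ c) < complexity (nestFreeMatchingPoly n ℝ≥0 * p) := by
    by_cases hrun : ∃ s : ℕ, s + (2 * ((Nat.log 2 n + c) ^ c + Nat.log 2 n + 1) ^ 6 + 12) ≤ 2 * n ∧
        ∀ j : Fin (2 * n), s ≤ j.val →
          j.val < s + (2 * ((Nat.log 2 n + c) ^ c + Nat.log 2 n + 1) ^ 6 + 12) → j ∉ R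
    · exact hn₁ n (le_of_max_le_left hn) R hrun p hp hint
    · exact hn₂ n (le_of_max_le_right hn) R hRa hrun p hp hpa hint
  show 2 ^ ((Nat.log 2 n + c) ^ c) <
    complexity (nestFreeMatchingPoly n ℝ≥0 * g) + complexity g
  calc 2 ^ ((Nat.log 2 n + c) ^ c) < complexity (nestFreeMatchingPoly n ℝ≥0 * p) := key
    _ ≤ complexity (nestFreeMatchingPoly n ℝ≥0 * g) := hpc
    _ ≤ complexity (nestFreeMatchingPoly n ℝ≥0 * g) + complexity g := Nat.le_add_right _ _

end Summit.ValiantsHypothesis.ValiantsHypothesis.Theorems.FifoMatching.NNLinearDegreeCofactorHard.InternalCofactor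

end
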